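import Literature.NumberTheory.EllipticCurves.AnticyclotomicTowerSharpProofs
import Literature.NumberTheory.EllipticCurves.AnticyclotomicTowerSharpOfSplittingProofs
import Literature.NumberTheory.EllipticCurves.ZpExtensionAnticyclotomicRingClassSplittingProofs
import HarnessLib

/-!
# Crux `BeyondCarrierDepthX10b` (stmt-BirchSwinnertonDyer-23055, PrintX10b aside r301), line «twins», skeleton v8
# (`Cruxes/BeyondCarrierDepthX10b/Lines/twins.lean`, sha d9aa95dab226): the registered stub `stub_anticyclotomicTowerSharp`
# (Tower♯, `K_k ⊆ K[p^{k+1}]`) CLOSED IN THE KERNEL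

HONEST FRAMING (cell `run/shared/lean/pub/bsd-print-x9/`, seat bsd-line-x10b-p1 LEAD g10; D-0154 KEY row 10): THEOREMS ONLY;
`--supports stmt-BirchSwinnertonDyer-23055` with stub credit (registered name + signature verbatim). The stub is classical
class field theory (Cox Thm. 7.24 / 11.1, Perrin-Riou 1987 §3.2: for `K` imaginary quadratic, `p` odd, `κ` the anticyclotomic
`ℤ_p`-extension, the `k`-th layer `K_k` lies in the ring class field `K[p^{k+1}]` at EVERY class number), now an unconditional
tree theorem: `Literature.NumberTheory.EllipticCurves.anticyclotomicTowerSharp` (x10b-p1-w2 g12, p681041) over the idèlic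
splitting statement `ZpExtension.mem_splitPrimes_layer_of_eq_span_of_sub_intCast_mem` (p680643; local odd-`p` lemma p680094,
x9-p1-w4 g10) and the Bauer/`jbar`-transfer end piece (p681041 §2–§3; equivalently this seat's p680687
`ringClassSubgroup_pow_succ_le_layerSubgroup_of_principal_splits`, recorded below as a second derivation).
«beyond-print theorem»: NO (classical). BSD is not proved by any of this; no summit statement is proved by this seat; the crux
23055 itself stays open (its other stubs are print-bound: s1/s2b/s2d/s3 modulo cite-only facts, s2c modulo the three print
leaves of the closed μ-crux 23428).

* `stub_anticyclotomicTowerSharp` — THE REGISTERED STUB, verbatim, `:= anticyclotomicTowerSharp`.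
* `stub_anticyclotomicTowerSharp_of_splitting` — the same statement by the second road (p680687 ∘ p680643), kept as a
  cross-check of the two independent end pieces.
References: [Cox2013] Thm. 7.24, 9.2, 11.1; [PerrinRiou1987BSMF] §3.2; [NeukirchANT1999] VII (13.9);
[CastellaGrossiLeeSkinner2022] §4.1 (d(k)).
-/

-- the REGISTERED stub namespace `Summit.BirchSwinnertonDyer.BirchSwinnertonDyer.Cruxes.…` repeats the summit name
set_option linter.dupNamespace false
set_option autoImplicit false

noncomputable section

open IsDedekindDomain NumberField

namespace Summit.BirchSwinnertonDyer.BirchSwinnertonDyer.Cruxes.BeyondCarrierDepthX10b.HowardFrames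

open Literature.NumberTheory.EllipticCurves

/-- **Registered stub `stub_anticyclotomicTowerSharp` of skeleton v8 (line «twins», crux 23055), CLOSED**: for `K` imaginary
quadratic, `p` odd, `κ` an anticyclotomic `ℤ_p`-extension, every `jbar : K̄ → ℂ` and every `k`,
`Gal(K̄/K[p^{k+1}]) ≤ Gal(K̄/K_k)`, i.e. `K_k ⊆ K[p^{k+1}]` (= the routes' support item `AnticyclotomicTowerSharp` BY SIGNATURE).
Proof: the tree theorem `anticyclotomicTowerSharp` (p681041). [cite: Cox2013, §7.D Thm. 7.24 and §11.A Thm. 11.1]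
[cite: PerrinRiou1987BSMF, §3.2] [cite: CastellaGrossiLeeSkinner2022, §4.1 (d(k))] -/
theorem stub_anticyclotomicTowerSharp :
    ∀ (K : Type) [Field K] [NumberField K] (p : ℕ) [Fact p.Prime], Odd p →
    Literature.NumberTheory.EllipticCurves.IsImaginaryQuadratic K →
    ∀ (κ : Literature.NumberTheory.EllipticCurves.ZpExtension K p), κ.IsAnticyclotomic →
    ∀ (jbar : AlgebraicClosure K →+* ℂ) (k : ℕ),
    Literature.NumberTheory.EllipticCurves.ringClassSubgroup K (p ^ (k + 1)) jbar ≤ κ.layerSubgroup k :=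
  anticyclotomicTowerSharp

/-- **The same stub by the second road** (cross-check): the splitting statement p680643
(`ZpExtension.mem_splitPrimes_layer_of_eq_span_of_sub_intCast_mem`: every `v ∤ p` with `𝔭_v = (α)`, `p^{k+1} ∣ α − n`, `n ∈ ℤ`,
`p ∤ n`, splits completely in `K_k`) fed into this seat's end piece p680687
(`ringClassSubgroup_pow_succ_le_layerSubgroup_of_principal_splits`: Bauer + the `jbar`-transfer).
[cite: Cox2013, §9.A Thm. 9.2 and §11.A Thm. 11.1] [cite: NeukirchANT1999, Ch. VII Prop. (13.9)] [cite: PerrinRiou1987BSMF, §3.2] -/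
theorem stub_anticyclotomicTowerSharp_of_splitting :
    ∀ (K : Type) [Field K] [NumberField K] (p : ℕ) [Fact p.Prime], Odd p →
    Literature.NumberTheory.EllipticCurves.IsImaginaryQuadratic K →
    ∀ (κ : Literature.NumberTheory.EllipticCurves.ZpExtension K p), κ.IsAnticyclotomic →
    ∀ (jbar : AlgebraicClosure K →+* ℂ) (k : ℕ),
    Literature.NumberTheory.EllipticCurves.ringClassSubgroup K (p ^ (k + 1)) jbar ≤ κ.layerSubgroup k := by
  intro K _ _ p _ hp hK κ hκ jbar k
  have hp2 : p ≠ 2 := by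
    rintro rfl
    exact (Nat.not_odd_iff_even.mpr (by decide) hp).elim
  exact ringClassSubgroup_pow_succ_le_layerSubgroup_of_principal_splits hK κ jbar k
    fun v α n hpv hn hα hdvd ↦
      ZpExtension.mem_splitPrimes_layer_of_eq_span_of_sub_intCast_mem hK hp2 κ hκ k hpv hα hn
        (Ideal.mem_span_singleton.mpr hdvd)

end Summit.BirchSwinnertonDyer.BirchSwinnertonDyer.Cruxes.BeyondCarrierDepthX10b.HowardFrames

end
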